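import Literature.IUT.HodgeArakelov.GaloisPairCyclotomesCor111Genuine
import Literature.IUT.HodgeArakelov.AbsTopMonoidsGenuineOfSetting
import Literature.AnabelianGeometry.SemiGraphs.TemperedCurveGaloisInfinite
import HarnessLib

/-!
# [IUTchII] Cor. 1.11 with ALL FOUR inputs genuine — over THE SETTING'S OWN FIELD `K` (the `(k, ε)` binder of
# abc-iut-w4-d030's `EtaleLevels.exists_cor111FunctorCor110_familyLim_multiradiallyDefined_of_base` INSTANTIATED)

S. Mochizuki, *Inter-universal Teichmüller theory II*, §1, Cor. 1.11 (kurims p. 49) [claim: Mochizuki2012, status: disputed].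
abc-iut-w4-d030's `GaloisPairCyclotomesCor111Genuine.lean` (p431925) proves the Cor. 1.11 functor `ℛ → ℱ` multiradially defined
over the [EtTh]-model setting `EtaleLevels.setting` with GENUINE monoids / twist / rigidity input / Cor. 1.10 family, for an
ARBITRARY non-archimedean local field `k` together with an identification `ε` of the setting's `G_K` with `Gal(k̄/k)` of the
standard closure `MLFClosure.std k`.  THIS PROOF-ONLY FILE (one theorem, no definitions) takes `k := K`, the setting's own base
field `K ⊆ ℚ̄_p` with its extended absolute value (abc-iut L4/S `FiniteExtension.*`), for which `MLFClosure.std K` IS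
abc-iut-w5-d233's `TemperedCurve.mlfClosure` (p430710) definitionally, and `ε := TemperedCurve.galoisEpsilon` (the Galois
identification `G_K = K.fixingSubgroup ⥲ Gal(K̄_K/K)` of abc-iut-L3) — so that NO model identification is left as a binder:
the residual inputs are exactly w4-d030's, i.e. (H1) `hΔ`, (H2) `hq`, and the (E)+(C) datum `(c, hE, hC')` of
`EtaleLevels.nonempty_galCorPiXInput_familyLim_iff` (GAP-LEDGER rows G-w5d145-1 and G-w5d145-2).

HONEST SCOPE: a specialisation, nothing else; no curve / theta setting asserted to exist; nothing here bears on [IUTchIII]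
Cor. 3.12; no side is taken; typed ≠ proved elsewhere.
-/

noncomputable section

namespace Literature.IUT.HodgeArakelov

open CategoryTheory Literature.AnabelianGeometry.AbsoluteAnabelian
open Literature.AnabelianGeometry.EtaleTheta Literature.AnabelianGeometry.SemiGraphs
open Literature.NumberTheory.GaloisRepresentations
open scoped Literature.AnabelianGeometry.EtaleTheta

namespace EtaleLevels

variable {p : ℕ} [Fact p.Prime] {D : Literature.AnabelianGeometry.EtaleTheta.ThetaSetting p}
  {E : D.EtaleThetaData} {l : ℕ} (C : E.DoubleUnderline l) (hC : D.Compat) (hS : D.Sec2Hyps)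
  (hl : l.Prime) (hp2 : p ≠ 2) (hpl : p ≠ l) (hζ : ∃ ζ : D.K, IsPrimitiveRoot ζ (4 * l))
  (mods : ∀ M : ℕ+, D.CyclotomeMod l M)
  (f : contCocycles D.toTheta D.DeltaTheta C.GtpYdduu) (hf : f ∈ C.rootCocycles hC)
  (hmods : ∀ (M M' : ℕ+) (h : (M : ℕ) ∣ (M' : ℕ)) (x : D.lDeltaTheta l),
    MuN.red p M M' h ((mods M').red x) = (mods M).red x)
  (h15 : Literature.AnabelianGeometry.EtaleTheta.ThetaSetting.Prop15iii E hC) (L : C.CuspLabels)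
  (hZ : ∀ M : ℕ+, Nonempty (ModelCyclotomes.lDeltaQuot (C.rigidData (mods M) hC hS h15 L) ≃*
    Literature.IUT.HodgeTheaters.ZHat))
  (h218i₁ : (levelRigid C hC hS mods h15 L 1).Cor218_i)
  [CompactSpace (setting C hC hS hl hp2 hpl hζ mods f hf).Gk]
  (hΔ : ∀ g : (setting C hC hS hl hp2 hpl hζ mods f hf).PiX ≃ₜ* (setting C hC hS hl hp2 hpl hζ mods f hf).PiX,
    (setting C hC hS hl hp2 hpl hζ mods f hf).DeltaX.map g.toMulEquiv.toMonoidHom =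
      (setting C hC hS hl hp2 hpl hζ mods f hf).DeltaX)
  (hq : Nonempty (TopGroup.quot (setting C hC hS hl hp2 hpl hζ mods f hf).PiX
    (setting C hC hS hl hp2 hpl hζ mods f hf).DeltaX ≃ₜ* (setting C hC hS hl hp2 hpl hζ mods f hf).Gk))

/-- **[IUTchII] Cor. 1.11 with all four inputs genuine, over the setting's OWN base field `K`** (abc-iut-w4-d030's
`exists_cor111FunctorCor110_familyLim_multiradiallyDefined_of_base` at `k := K ⊆ ℚ̄_p` with its extended absolute value and
`ε := TemperedCurve.galoisEpsilon`, the Galois identification `G_K ⥲ Gal(K̄_K/K)`): given (H1) `hΔ`, (H2) `hq` and the (E)+(C)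
datum `(c, hE, hC')` at `Π₀`, the functor `ℛ → ℱ` of Cor. 1.11 over the GENUINE monoids `genuineOfModel (setting …)
K.mlfClosure K.galoisEpsilon`, the genuine `Ẑ^×`-twist, the unconditional rigidity input and Cor. 1.10's genuine family
`familyLim` EXISTS and is multiradially defined. [claim: Mochizuki2012, status: disputed] (IUTchII §1 Cor 1.11, kurims p.49) -/
theorem exists_cor111FunctorCor110_familyLim_multiradiallyDefined_of_base_ownField
    (c : ↥((AbsTopMonoids.genuineOfModel (setting C hC hS hl hp2 hpl hζ mods f hf) D.toTemperedCurve.mlfClosure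
            D.toTemperedCurve.galoisEpsilon hΔ hq).quotObj
          (basePointLim C hC hS hl hp2 hpl hζ mods f hf hmods h15 L hZ)).galCyclotome ≃*
        (baseDatumLim C hC hS hl hp2 hpl hζ mods f hf hmods h15 L hZ h218i₁).A)
    (hE : ∀ (x : (basePointLim C hC hS hl hp2 hpl hζ mods f hf hmods h15 L hZ).G)
        (ζ : ((AbsTopMonoids.genuineOfModel (setting C hC hS hl hp2 hpl hζ mods f hf) D.toTemperedCurve.mlfClosure
            D.toTemperedCurve.galoisEpsilon hΔ hq).quotObj
          (basePointLim C hC hS hl hp2 hpl hζ mods f hf hmods h15 L hZ)).galCyclotome),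
      c (haveI := ((AbsTopMonoids.genuineOfModel (setting C hC hS hl hp2 hpl hζ mods f hf) D.toTemperedCurve.mlfClosure
            D.toTemperedCurve.galoisEpsilon hΔ hq).quotObj
            (basePointLim C hC hS hl hp2 hpl hζ mods f hf hmods h15 L hZ)).compactSpace_carrier;
          (QuotientGroup.mk x : _ ⧸ (AbsTopMonoids.genuineOfModel (setting C hC hS hl hp2 hpl hζ mods f hf)
            D.toTemperedCurve.mlfClosure D.toTemperedCurve.galoisEpsilon hΔ hq).Delta _) • ζ) =
        (baseDatumLim C hC hS hl hp2 hpl hζ mods f hf hmods h15 L hZ h218i₁).actA x (c ζ))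
    (hC' : ∀ (γ : basePointLim C hC hS hl hp2 hpl hζ mods f hf hmods h15 L hZ ⟶
          basePointLim C hC hS hl hp2 hpl hζ mods f hf hmods h15 L hZ)
        (ζ : ((AbsTopMonoids.genuineOfModel (setting C hC hS hl hp2 hpl hζ mods f hf) D.toTemperedCurve.mlfClosure
            D.toTemperedCurve.galoisEpsilon hΔ hq).quotObj
          (basePointLim C hC hS hl hp2 hpl hζ mods f hf hmods h15 L hZ)).galCyclotome),
      c (IsoClass.galCyclotomeMap
          ((AbsTopMonoids.genuineOfModel (setting C hC hS hl hp2 hpl hζ mods f hf) D.toTemperedCurve.mlfClosure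
            D.toTemperedCurve.galoisEpsilon hΔ hq).quotMap γ) ζ) =
        (baseDatumLim C hC hS hl hp2 hpl hζ mods f hf hmods h15 L hZ h218i₁).rhoA (IsoClass.homIso γ) (c ζ))
    (Γ : Subgroup ZHatUnits) (Γ' : Type) [Group Γ'] :
    ∃ (R : GalRigidityInput
        (AbsTopMonoids.genuineOfModel (setting C hC hS hl hp2 hpl hζ mods f hf) D.toTemperedCurve.mlfClosure
          D.toTemperedCurve.galoisEpsilon hΔ hq))
      (I : GalCorPiXInput
        (AbsTopMonoids.genuineOfModel (setting C hC hS hl hp2 hpl hζ mods f hf) D.toTemperedCurve.mlfClosure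
          D.toTemperedCurve.galoisEpsilon hΔ hq)
        (familyLim C hC hS hl hp2 hpl hζ mods f hf hmods h15 L hZ h218i₁)),
      ((ex18iii (setting C hC hS hl hp2 hpl hζ mods f hf) Γ').toDagger
        (cor111FunctorCor110 (GalTwistInput.ofZHat (setting C hC hS hl hp2 hpl hζ mods f hf)) R
          (familyLim C hC hS hl hp2 hpl hζ mods f hf hmods h15 L hZ h218i₁) I Γ Γ')).IsMultiradiallyDefined := by
  letI : IsNonarchimedeanLocalField ℚ_[p] := Padic.isNonarchimedeanLocalField_holds p
  haveI : FiniteDimensional ℚ_[p] D.K := D.finiteDimensional_K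
  letI := FiniteExtension.valuativeRel ℚ_[p] D.K
  letI := FiniteExtension.topologicalSpace ℚ_[p] D.K
  haveI := FiniteExtension.isNonarchimedeanLocalField ℚ_[p] D.K
  haveI : CharZero D.K := charZero_of_injective_algebraMap (algebraMap ℚ_[p] D.K).injective
  exact exists_cor111FunctorCor110_familyLim_multiradiallyDefined_of_base C hC hS hl hp2 hpl hζ mods f hf hmods h15
    L hZ h218i₁ D.K D.toTemperedCurve.galoisEpsilon hΔ hq c hE hC' Γ Γ'

end EtaleLevels

end Literature.IUT.HodgeArakelov

end
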